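import Summits.AtomisticToContinuum.Crystallization.Theses.PricedLinkCensus
import Summits.AtomisticToContinuum.Crystallization.Theorems.ChargedEnergyGap.Negative.PeriodicFormConverse

/-!
# The finite-range census gap implies the periodic pricing for `V_χ` (modulo block trial states)

Stub `periodicPricing_of_truncatedCensusGap_of_blocks` (CRUX ⇒ PERIODIC PRICING) of the line
`sharp-m-potential-compactness` for the crux `PricedLinkCensus.TruncatedCensusGap`
(item stmt-AtomisticToContinuum-14230).  The statement below is the registered signature VERBATIM.

Write `V_χ r = min 1 (max 0 (4 - 2r)) · V_LJ r` for the range-2 truncated Lennard-Jones potential and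
`e_χ* = ⨅_Q e_{V_χ}(Q)` for the infimum of its energy per particle over periodic configurations of
`ℝ³`.  The crux `TruncatedCensusGap` is (definitionally) the allowance-free priced gap
`N · e_χ* + κ · #(charged sites of y) ≤ E_χ(y)` for every finite injective `y`, some `κ > 0`.

**Theorem.**  Assume the block trial-state lemma for `V_χ` (first hypothesis: for every periodic
`Q` and `ε > 0`, all large `K³`-blocks `blockConfig Q K` of `Q` have `V_χ`-energy at most
`#block · (e_{V_χ}(Q) + ε)`).  Then the crux implies the PERIODIC PRICING for `V_χ`: with the same
`κ > 0`, every periodic configuration `Q` pays `κ` per charged motif site above `e_χ*`,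
`κ · motifCharged (1/100) Q ≤ #motif · (e_{V_χ}(Q) − e_χ*)`.

This is the `V_χ` twin of `ChargedEnergyGapNegative.Blocks.periodicPricing_of_noBoundary`
(`ChargedEnergyGap/Negative/PeriodicFormConverse`), and the proof is the same: apply the
allowance-free gap to the blocks; by `Blocks.isChargeFree_block_iff` (potential-independent),
`lvl3`-deep block points are charged in the block iff their motif point is charged in `Q`
(`Blocks.card_charged_block_ge`, `Blocks.charged_blockConfig_eq`); non-deep lattice coordinates are
at most `6 · lvl3 · K²` (`Blocks.card_deep_ge`); blocks are trial states (the hypothesis).  If the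
pricing failed at `Q` by a margin `δ > 0`, a block with `K ≥ K₀(δ / 3#F)`, `K ≥ 6 lvl3` and
`6 · lvl3 · κ · mC ≤ (δ/3) · K` would violate the gap.
-/

noncomputable section

namespace Summit.AtomisticToContinuum.Crystallization.Theorems.PricedLinkCensusTruncatedCensusGap

open Literature.MathematicalPhysics.StatisticalMechanics Literature.Geometry.DiscreteGeometry
open Summit.AtomisticToContinuum.Crystallization.Theorems.ChargedEnergyGapNegative
open Summit.AtomisticToContinuum.Crystallization.Theorems.ChargedEnergyGapNegative.Blocks

/-- **The crux implies the periodic pricing for `V_χ`, modulo the block trial-state lemma.**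
If all large blocks of every periodic configuration are `V_χ`-trial states (first hypothesis) and
the finite-range census gap `TruncatedCensusGap` holds, then for some `κ > 0` every periodic
configuration `Q` of `ℝ³` satisfies `κ · motifCharged (1/100) Q ≤ #motif · (e_{V_χ}(Q) − e_χ*)`,
`e_χ* = ⨅_{Q'} e_{V_χ}(Q')`.  Twin of `Blocks.periodicPricing_of_noBoundary`. [folklore] -/
theorem periodicPricing_of_truncatedCensusGap_of_blocks : (∀ (Q : PeriodicConfiguration 3) (ε : ℝ), 0 < ε → ∃ K₀ : ℕ, 0 < K₀ ∧ ∀ K : ℕ, K₀ ≤ K → interactionEnergy (fun r => min 1 (max 0 (4 - 2 * r)) * lennardJones r) (Summit.AtomisticToContinuum.Crystallization.Theorems.ChargedEnergyGapNegative.Blocks.blockConfig Q K) ≤ (Fintype.card (Summit.AtomisticToContinuum.Crystallization.Theorems.ChargedEnergyGapNegative.Blocks.BIdx Q K) : ℝ) * (Q.energyPerParticle (fun r => min 1 (max 0 (4 - 2 * r)) * lennardJones r) + ε)) → Summit.AtomisticToContinuum.Crystallization.Theses.PricedLinkCensus.TruncatedCensusGap → (∃ κ : ℝ, 0 < κ ∧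 ∀ Q : PeriodicConfiguration 3, κ * (Summit.AtomisticToContinuum.Crystallization.Theorems.ChargedEnergyGapNegative.motifCharged (1 / 100) Q : ℝ) ≤ (Q.motif.card : ℝ) * (Q.energyPerParticle (fun r => min 1 (max 0 (4 - 2 * r)) * lennardJones r) - ⨅ Q' : PeriodicConfiguration 3, Q'.energyPerParticle (fun r => min 1 (max 0 (4 - 2 * r)) * lennardJones r))) := by
  intro hblocks htcg
  obtain ⟨κ, hκ, hgap⟩ := htcg
  refine ⟨κ, hκ, fun Q => ?_⟩
  -- name the potential and the periodic infimum
  set V : ℝ → ℝ := fun r => min 1 (max 0 (4 - 2 * r)) * lennardJones r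
  set e : ℝ := ⨅ Q' : PeriodicConfiguration 3, Q'.energyPerParticle V
  by_contra hlt
  rw [not_le] at hlt
  have hF : (0 : ℝ) < Q.motif.card := by exact_mod_cast Q.motif_nonempty.card_pos
  set δ := κ * (motifCharged (1 / 100) Q : ℝ) -
    (Q.motif.card : ℝ) * (Q.energyPerParticle V - e) with hδ
  have hδ0 : 0 < δ := by rw [hδ]; linarith
  -- blocks are trial states with slack `δ / (3 #F)` per particle (the hypothesis)
  obtain ⟨K₀, hK₀, hK⟩ := hblocks Q (δ / (3 * Q.motif.card)) (by positivity)
  -- a large `K`: beyond `K₀`, beyond `6·lvl3`, and with `6·lvl3·κ·mC ≤ (δ/3)·K`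
  obtain ⟨K₁, hK₁⟩ := exists_nat_gt (18 * (lvl3 Q) * κ * (motifCharged (1 / 100) Q) / δ)
  set K := max K₀ (max (6 * lvl3 Q) (K₁ + 1))
  have hKK₀ : K₀ ≤ K := le_max_left _ _
  have hK6 : 6 * lvl3 Q ≤ K := (le_max_left _ _).trans (le_max_right _ _)
  have hKK₁ : K₁ + 1 ≤ K := (le_max_right _ _).trans (le_max_right _ _)
  have hKpos : (0 : ℝ) < K := by exact_mod_cast lt_of_lt_of_le hK₀ hKK₀
  have hK1r : (K₁ : ℝ) + 1 ≤ K := by exact_mod_cast hKK₁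
  -- the allowance-free gap on the block (the crux, specialised)
  have hgapK : ((Fintype.card (BIdx Q K) : ℕ) : ℝ) * e +
      κ * (charged (1 / 100) (blockConfig Q K) : ℝ) ≤ interactionEnergy V (blockConfig Q K) :=
    hgap _ (blockConfig Q K) (blockConfig_injective Q K)
  rw [charged_blockConfig_eq] at hgapK
  have hn : ((Fintype.card (BIdx Q K) : ℕ) : ℝ) = Q.motif.card * (K : ℝ) ^ 3 := by
    exact_mod_cast card_BIdx Q K
  rw [hn] at hgapK
  have hE := hK K hKK₀
  rw [hn] at hE
  -- charged block points: at least `(K³ − 6·lvl3·K²)·mC`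
  have hch := card_charged_block_ge Q K (η := 1 / 100) (by norm_num) (by norm_num)
  have hdeep := card_deep_ge K (lvl3 Q)
  have hchR : ((K : ℝ) ^ 3 - 6 * (lvl3 Q) * (K : ℝ) ^ 2) * (motifCharged (1 / 100) Q : ℝ) ≤
      (Nat.card {u : BIdx Q K // ¬ IsChargeFree (1 / 100 : ℝ) (bpt Q K) u} : ℝ) := by
    have h1 : ((K : ℝ) ^ 3 - 6 * (lvl3 Q) * (K : ℝ) ^ 2) ≤
        (Nat.card {k : Fin 3 → Fin K // IsDeep K (lvl3 Q) k} : ℝ) := by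
      have := (Nat.cast_le (α := ℝ)).2 hdeep; push_cast at this ⊢; linarith
    have h2 : ((Nat.card {k : Fin 3 → Fin K // IsDeep K (lvl3 Q) k} : ℕ) : ℝ) *
        (motifCharged (1 / 100) Q : ℝ) ≤
        (Nat.card {u : BIdx Q K // ¬ IsChargeFree (1 / 100 : ℝ) (bpt Q K) u} : ℝ) := by
      exact_mod_cast hch
    nlinarith [Nat.cast_nonneg (α := ℝ) (motifCharged (1 / 100) Q)]
  -- `6·lvl3·κ·mC·K² ≤ (δ/3)·K³`
  have hsmall : 6 * (lvl3 Q) * κ * (motifCharged (1 / 100) Q : ℝ) * (K : ℝ) ^ 2 ≤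
      δ / 3 * (K : ℝ) ^ 3 := by
    have h1 : 18 * (lvl3 Q) * κ * (motifCharged (1 / 100) Q : ℝ) / δ < K := by linarith
    rw [div_lt_iff₀ hδ0] at h1
    have hK2 : (0 : ℝ) ≤ (K : ℝ) ^ 2 := by positivity
    nlinarith
  -- combine: `κ·(K³ − 6LK²)·mC ≤ κ·#charged ≤ E − n e_χ* ≤ n(e(Q) − e_χ*) + n·δ/(3F)`
  have hmono : κ * (((K : ℝ) ^ 3 - 6 * (lvl3 Q) * (K : ℝ) ^ 2) * (motifCharged (1 / 100) Q : ℝ)) ≤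
      κ * (Nat.card {u : BIdx Q K // ¬ IsChargeFree (1 / 100 : ℝ) (bpt Q K) u} : ℝ) :=
    mul_le_mul_of_nonneg_left hchR hκ.le
  have hK3 : (0 : ℝ) < (K : ℝ) ^ 3 := by positivity
  have key : (K : ℝ) ^ 3 * (κ * (motifCharged (1 / 100) Q : ℝ) - δ / 3) ≤
      (K : ℝ) ^ 3 * ((Q.motif.card : ℝ) * (Q.energyPerParticle V - e) + δ / 3) := by
    have hE' : interactionEnergy V (blockConfig Q K) ≤
        (Q.motif.card : ℝ) * (K : ℝ) ^ 3 * Q.energyPerParticle V + (K : ℝ) ^ 3 * (δ / 3) := by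
      have : (Q.motif.card : ℝ) * (K : ℝ) ^ 3 * (δ / (3 * Q.motif.card)) =
          (K : ℝ) ^ 3 * (δ / 3) := by
        field_simp
      nlinarith
    nlinarith
  have := le_of_mul_le_mul_left key hK3
  rw [hδ] at this
  linarith

end Summit.AtomisticToContinuum.Crystallization.Theorems.PricedLinkCensusTruncatedCensusGap

end
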